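import Literature.Algebra.EuclideanLattices.KhotExplicitReduction
import Literature.Algebra.EuclideanLattices.KhotMachineFP
import Literature.Computability.Complexity.GapSetCoverProofs
import Literature.Computability.Complexity.E3InstanceMachine
import Literature.Computability.Complexity.GapAssembly
import HarnessLib

/-!
# Khot 2005, Thm. 1.1: the named fact `Khot2005_SAT_randReducible_gapSVP` assembled down to its two open leaves

Topic `Algebra/EuclideanLattices`, namespace `Literature.Algebra.EuclideanLattices` (the namespace of the
fact; helper names from `…Khot`). Sibling proofs file of `KhotSVPHardness.lean`, which vendors Khot's
theorem (J. ACM 52 (2005), Thm. 1.1, first assertion, `p = 2`) as the named fact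
`Khot2005_SAT_randReducible_gapSVP : ∀ γ₀ ≥ 1, PromiseRandReducible (ofLanguage SAT) (GapSVP_{γ₀})`,
and the designated home of its discharge `Khot2005_SAT_randReducible_gapSVP_holds`.

The decomposition of the fact is landed across `KhotTensorBoost` … `KhotParameters` (the lattice
mathematics of §3–§7, proved), `KhotGapInstancesParam` / `KhotReduction` / `KhotExplicitReduction`
(the gap-instance theorem for the completely specified output map `Khot.khotOutputExplicit k`, the
coin decoding and the probability bookkeeping, proved), `SatUnsatPromiseHard` / `KhotNPHardness`
(Cook–Levin and composition glue, proved) and, on the PCP side, `GapSetCover` / `LundYannakakis*` /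
`GapSetCoverProofs` (Arora–Babai–Stern–Sweedyk 1997, Prop. 6 reduced to the NP-hardness of gap label
cover, proved). This file records, WITH PROOF, that the fact now follows from exactly two statements,
each the target of its own line of work in the tree, and nothing else:

1. **(PCP leaf)** the NP-hardness of gap label cover for every constant soundness error,
   `∀ ε > 0, ∃ W, (gapLabelCover W ε).IsNPHard` (PCP theorem + parallel repetition; it gives
   `AroraEtAl1997_prop6` by `AroraEtAl1997_prop6_of_isNPHard_gapLabelCover`), or directly the named
   fact `AroraEtAl1997_prop6` (`GapSetCover.lean`), or Raz's theorem in the printed form of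
   Arora–Barak 2009, Thm. 22.15 (`AroraEtAl1997_prop6_of_raz`);
2. **(machine leaf)** for every number of levels `k`, SOME polynomial-time string function computes
   the explicit total output map on codes,
   `∃ F ∈ FP, ∀ I c, F ⟨code I, c⟩ = code (Khot.khotOutputExplicit k I c)`
   (Khot 2005, §7.3: "the reduction runs in time `n^{O(k²)}`", for the map with the explicit BCH
   block `khotBCH` and the explicit enumerations of `khotDataExplicit`; the hypothesis `h₂` of
   `Khot.gapSVP_const_isNPHardRandomized_of_prop6_of_FP_explicit`, verbatim).

* `Khot2005_SAT_randReducible_gapSVP_of_prop6_of_FP_explicit` — the fact from `AroraEtAl1997_prop6`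
  and the machine leaf (for `γ₀ ≥ 1` take `k` with `8γ₀² < (8/7)^k`, `Khot.exists_levels`, and the
  randomised reduction `gapSetCover 40 → GapSVP_{γ₀}` of
  `Khot.promiseRandReducible_gapSetCover_gapSVP_of_FP_explicit`; then
  `Khot2005_SAT_randReducible_gapSVP_of_gapSetCover`);
* `Khot2005_SAT_randReducible_gapSVP_of_isNPHard_gapLabelCover_of_FP_explicit` — the same from the
  label-cover form of the PCP leaf;
* `Khot2005_SAT_randReducible_gapSVP_of_raz_of_FP_explicit` — the same from Raz's theorem as printed
  in Arora–Barak 2009, Thm. 22.15;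
* `gapSVP_const_isNPHardRandomized_of_isNPHard_gapLabelCover_of_FP_explicit` — the companion for the
  statement-file fact pqc.S17 (`gapSVP_const_isNPHardRandomized`, `LatticeComplexity.lean`), which
  `Khot2005_SAT_randReducible_gapSVP` implies (`gapSVP_const_isNPHardRandomized_of_SAT_randReducible`).

Why the fact is kept in the `PromiseRandReducible` form down to the leaves rather than derived from
pqc.S17: `IsNPHardRandomized` is stated with the lattice file's budget-free notion
`RandPolyTimeReducible`, whereas `PromiseRandReducible` (`MetaComplexity/PromiseRandReductions.lean`)
carries the exact polynomial coin budget `A.coinLen n = q(n)` of Arora–Barak, Def. 7.3; the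
implication `PromiseRandReducible → RandPolyTimeReducible` is proved
(`RandPolyTimeReducible.of_promiseRandReducible`), the converse is not available in the model, so
pqc.S17 does not formally give back Khot's fact and both must be fed from the common source
`Khot.promiseRandReducible_gapSetCover_gapSVP_of_FP_explicit`. No definitions, no new facts.

## References

* S. Khot, *Hardness of approximating the shortest vector problem in lattices*, J. ACM 52 (2005)
  789–808: Thm. 1.1 (p. 791), Thm. 3.1, §7.3 (p. 806: "choosing `k` to be a large enough constant
  … a reduction that runs in time `n^{O(k²)}`").
* S. Arora, L. Babai, J. Stern, Z. Sweedyk, *The hardness of approximate optima in lattices, codes,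
  and systems of linear equations*, J. Comput. Syst. Sci. 54 (1997) 317–331, Prop. 6 (p. 319).
* S. Arora, B. Barak, *Computational Complexity: A Modern Approach*, CUP 2009, Thm. 22.15 (p. 473),
  Thm. 22.31 (§22.8), Def. 7.3, §7.6.
-/

noncomputable section

open Computability Literature.Computability.Complexity Literature.Computability.MetaComplexity
  Literature.Computability.Complexity.PromiseProblem

namespace Literature.Algebra.EuclideanLattices

open Khot

/-- **Khot's fact from `AroraEtAl1997_prop6` and a machine for the explicit map.**
`Khot2005_SAT_randReducible_gapSVP` follows from the PCP-based gap set cover hardness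
`AroraEtAl1997_prop6` and, for every `k`, some `F ∈ FP` with
`F ⟨code I, c⟩ = code (khotOutputExplicit k I c)` for all set cover instances `I` and coin strings
`c`: given `γ₀ ≥ 1`, choose `k` with `8γ₀² < (8/7)^k` (`exists_levels`) and reduce
`gapSetCover 40 → GapSVP_{γ₀}` by `promiseRandReducible_gapSetCover_gapSVP_of_FP_explicit`.
[cite: Khot2005, Thm. 1.1 and §7.3] -/
theorem Khot2005_SAT_randReducible_gapSVP_of_prop6_of_FP_explicit (h₁ : AroraEtAl1997_prop6)
    (h₂ : ∀ k : ℕ, ∃ F : List Bool → List Bool, F ∈ FP ∧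
      ∀ (I : SetCoverInstance) (c : List Bool),
        F (boolPair (SetCoverInstance.encoding.encode I) c) = GapSVPInstance.encode (khotOutputExplicit k I c)) :
    Khot2005_SAT_randReducible_gapSVP :=
  Khot2005_SAT_randReducible_gapSVP_of_gapSetCover h₁ fun γ₀ hγ₀ => by
    obtain ⟨k, hk⟩ := exists_levels γ₀
    obtain ⟨F, hF, hFI⟩ := h₂ k
    exact ⟨40, by norm_num, promiseRandReducible_gapSetCover_gapSVP_of_FP_explicit hγ₀ hk hF hFI⟩

/-- **Khot's fact from the NP-hardness of gap label cover and a machine for the explicit map.**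
The PCP leaf in label-cover form — for every `ε > 0` some `gapLabelCover W ε` is NP-hard (PCP
theorem and parallel repetition) — gives `AroraEtAl1997_prop6` through the proved Lund–Yannakakis
reduction (`AroraEtAl1997_prop6_of_isNPHard_gapLabelCover`), and the previous theorem applies.
[cite: Khot2005, Thm. 1.1 and §7.3; AroraBarak2009, Thm. 22.31 (§22.8)] -/
theorem Khot2005_SAT_randReducible_gapSVP_of_isNPHard_gapLabelCover_of_FP_explicit
    (h₁ : ∀ ε : ℝ, 0 < ε → ∃ W : ℕ, (gapLabelCover W ε).IsNPHard)
    (h₂ : ∀ k : ℕ, ∃ F : List Bool → List Bool, F ∈ FP ∧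
      ∀ (I : SetCoverInstance) (c : List Bool),
        F (boolPair (SetCoverInstance.encoding.encode I) c) = GapSVPInstance.encode (khotOutputExplicit k I c)) :
    Khot2005_SAT_randReducible_gapSVP :=
  Khot2005_SAT_randReducible_gapSVP_of_prop6_of_FP_explicit (AroraEtAl1997_prop6_of_isNPHard_gapLabelCover h₁) h₂

/-- **Khot's fact from Raz's theorem (Arora–Barak 2009, Thm. 22.15, as printed) and a machine for
the explicit map**: "there is a `c > 1` such that for every `t > 1`, `GAP 2CSP_W(ε)` is NP-hard for
`ε = 2^{-t}`, `W = 2^{ct}`, also for regular instances with the projection property", through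
`AroraEtAl1997_prop6_of_raz`. [cite: Khot2005, Thm. 1.1 and §7.3; AroraBarak2009, Thm. 22.15 (p. 473)] -/
theorem Khot2005_SAT_randReducible_gapSVP_of_raz_of_FP_explicit
    (h₁ : ∃ c : ℕ, 1 < c ∧ ∀ t : ℕ, 1 < t → (gapLabelCover (2 ^ (c * t)) (1 / 2 ^ t)).IsNPHard)
    (h₂ : ∀ k : ℕ, ∃ F : List Bool → List Bool, F ∈ FP ∧
      ∀ (I : SetCoverInstance) (c : List Bool),
        F (boolPair (SetCoverInstance.encoding.encode I) c) = GapSVPInstance.encode (khotOutputExplicit k I c)) :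
    Khot2005_SAT_randReducible_gapSVP :=
  Khot2005_SAT_randReducible_gapSVP_of_prop6_of_FP_explicit (AroraEtAl1997_prop6_of_raz h₁) h₂

/-- **The statement-file fact pqc.S17 from the same two leaves** (label-cover form): for every
constant `γ₀ ≥ 1`, `GapSVP_{γ₀}` is NP-hard under randomised reductions
(`gapSVP_const_isNPHardRandomized`), by `gapSVP_const_isNPHardRandomized_of_SAT_randReducible`
(Cook–Levin and composition). [cite: Khot2005, Thm. 1.1 and §7.3] -/
theorem gapSVP_const_isNPHardRandomized_of_isNPHard_gapLabelCover_of_FP_explicit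
    (h₁ : ∀ ε : ℝ, 0 < ε → ∃ W : ℕ, (gapLabelCover W ε).IsNPHard)
    (h₂ : ∀ k : ℕ, ∃ F : List Bool → List Bool, F ∈ FP ∧
      ∀ (I : SetCoverInstance) (c : List Bool),
        F (boolPair (SetCoverInstance.encoding.encode I) c) = GapSVPInstance.encode (khotOutputExplicit k I c)) :
    gapSVP_const_isNPHardRandomized :=
  gapSVP_const_isNPHardRandomized_of_SAT_randReducible
    (Khot2005_SAT_randReducible_gapSVP_of_isNPHard_gapLabelCover_of_FP_explicit h₁ h₂)

/-- Pointwise form: ONE randomised reduction `ofLanguage SAT → GapSVP_{γ₀}` from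
`AroraEtAl1997_prop6` and a machine for the explicit map with ONE number of levels `k`,
`8γ₀² < (8/7)^k`. [cite: Khot2005, Thm. 1.1 and §7.3] -/
theorem promiseRandReducible_SAT_gapSVP_of_prop6_of_FP_explicit (h₁ : AroraEtAl1997_prop6) {γ₀ : ℝ}
    (hγ₀ : 1 ≤ γ₀) {k : ℕ} (hk : 8 * γ₀ ^ 2 < (8 / 7 : ℝ) ^ k) {F : List Bool → List Bool} (hF : F ∈ FP)
    (hFI : ∀ (I : SetCoverInstance) (c : List Bool),
      F (boolPair (SetCoverInstance.encoding.encode I) c) = GapSVPInstance.encode (khotOutputExplicit k I c)) :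
    PromiseRandReducible (ofLanguage SAT) (gapSVPPromise fun _ => γ₀) :=
  promiseRandReducible_SAT_gapSVP_of_gapSetCover h₁ (by norm_num)
    (promiseRandReducible_gapSetCover_gapSVP_of_FP_explicit hγ₀ hk hF hFI)

/-! ### The discharge, modulo the PCP theorem in gap-E3SAT form -/

/-- **Khot's theorem from a gap machine for E3SAT** (the PCP theorem in the form of
`GapAssembly.GapMachine`: a polynomial-time map producing E3-CNFs of value `≤ 1 - ε₁` from
unsatisfiable 3CNFs, `0 < ε₁ ≤ 1/8`): NP-hardness of `gapE3SAT (1/8 - ε₁)`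
(`gapE3SAT_isNPHard_of_gapMachine`), the tree's one-shot reduction to gap label cover of every
soundness error with its polynomial-time machine (`E3LC.isNPHard_gapLabelCover_forall_of_gapE3SAT_hard`,
`E3InstanceMachine.lean`), and the explicit machine of Khot's map (`Khot.khotOutputExplicit_mem_FP`).
[cite: Khot2005, Thm. 1.1 and §7.3; AroraBarak2009, Thm. 22.15] -/
theorem Khot2005_SAT_randReducible_gapSVP_of_gapMachine {ε₁ : ℚ}
    (M : Literature.Computability.Complexity.GapMachine ε₁) (hε0 : 0 < ε₁) (hε : ε₁ ≤ 1 / 8) :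
    Khot2005_SAT_randReducible_gapSVP :=
  Khot2005_SAT_randReducible_gapSVP_of_isNPHard_gapLabelCover_of_FP_explicit
    (Literature.Computability.Complexity.Expander.E3LC.isNPHard_gapLabelCover_forall_of_gapE3SAT_hard hε0 hε
      (Literature.Computability.Complexity.gapE3SAT_isNPHard_of_gapMachine M hε))
    Khot.khotOutputExplicit_mem_FP

/-! ### The discharge (appended 2026-08-15)

The PCP leaf has landed: Dinur's gap amplification on the Gabber–Galil expander kit, rendered in
Cobham's class, gives the gap machine `GapPV.ggMachine : GapMachine (GapPV.ε₁Q ggP)` with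
`0 < GapPV.ε₁Q ggP ≤ 1/8` (`ApproximationProofs.lean`, the cone of `pcp_theorem_exact_holds`,
visible here through `GapSetCoverProofs.lean`). Feeding it to
`Khot2005_SAT_randReducible_gapSVP_of_gapMachine` discharges the named fact. -/

/-- **Khot 2005, Thm. 1.1 (first assertion, `p = 2`), PROVED** — discharge of the named fact
`Khot2005_SAT_randReducible_gapSVP` of `KhotSVPHardness.lean`: for every constant `γ₀ ≥ 1`, SAT reduces
to `GapSVP_{γ₀}` by a randomised polynomial-time reduction (two-sided error, exact polynomial coin
budget). Proof: the PCP theorem in gap-E3SAT form (the gap machine `GapPV.ggMachine`,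
`gapE3SAT_isNPHard_of_gapMachine`), gap label cover for every constant soundness error
(`Expander.E3LC.isNPHard_gapLabelCover_forall_of_gapE3SAT_hard`), Lund–Yannakakis / Arora–Babai–Stern–Sweedyk
Prop. 6 (gap exact set cover), and Khot's randomised reduction with its explicit polynomial-time machine
(`Khot.khotOutputExplicit_mem_FP`) — all composed in `Khot2005_SAT_randReducible_gapSVP_of_gapMachine`.
[cite: Khot2005, Thm. 1.1 (p. 791) and §7.3 (p. 806)] -/
theorem Khot2005_SAT_randReducible_gapSVP_holds : Khot2005_SAT_randReducible_gapSVP :=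
  Khot2005_SAT_randReducible_gapSVP_of_gapMachine Literature.Computability.Complexity.GapPV.ggMachine
    (Literature.Computability.Complexity.GapPV.ε₁Q_pos _) (Literature.Computability.Complexity.GapPV.ε₁Q_le _)

end Literature.Algebra.EuclideanLattices
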